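import Literature.Algebra.Homology.StrictlyPerfectVanishingBaseChange
import HarnessLib

/-!
# `A ⊗_R P•` as a cochain complex of `A`-modules with the CANONICAL instances (plumbing for cohomology and base change)

Layer `Literature/Algebra/Homology`; namespace `Literature.Algebra.Homology`.  ONE definition with body (non-`Prop` plumbing:
`baseChangeComplex A P•`, `X n := A ⊗_R Pⁿ`, `d := d ⊗ A`) + three lemmas; no named fact, no instance, no notation, no `sorry`; books 0.

Why a separate carrier: Mathlib's `ModuleCat.extendScalars (algebraMap R A)` puts on `A ⊗_R M` the `RestrictScalars` module structure of
`A`, which is not DEFINITIONALLY the algebra's own when `A` is e.g. a localisation `R_𝔪` (★ `Modules/TildeLocallyFree.extendScalarsIsoBaseChange`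
is the comparison); for «cohomology and base change» globalised over the maximal ideals (★ `Modules/CechComplexExactOfFibrewiseExact`,
[MumfordAV1970] §5 Cor. 3) one wants `R_𝔪 ⊗_R P•` as an honest complex of `R_𝔪`-modules on which Mathlib's base-change instances
(`Module.Finite`, `Module.Projective`, `Module.Flat`, `IsScalarTower R R_𝔪 κ(𝔪)`) apply verbatim — this file is that carrier.
* `baseChangeComplex A P`, `baseChangeComplex_d_hom` (rfl), `isStrictlyLE_baseChangeComplex`, `finite_projective_baseChangeComplex_X`.
Cell hodgecm-mathlib (D-0151), P6 «MOD programme», DUAL-S road (A), brick (CBC-1) of B-p08 (g33)'s «CBC CUT» (B-p04 (g40)); count-neutral.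
HC_CM is proved only modulo the printed citations (2 remaining named inputs hLiu418 24832, h413 24833) until rung 0 closes.

## References
* [MumfordAV1970] D. Mumford, *Abelian Varieties* (1970), §5 Lemma 1 (p. 47), Lemma 2 (p. 49) («`K• ⊗_A B`»).
* [GortzWedhorn2023] U. Görtz, T. Wedhorn, *Algebraic Geometry II* (2023), Def. 21.68, Remark 21.92 (2) (base change of complexes).
-/

set_option autoImplicit false

universe u

open CategoryTheory CategoryTheory.Limits TensorProduct Module

noncomputable section

namespace Literature.Algebra.Homology

variable {R : Type u} [CommRing R]

/-- **`A ⊗_R P•` as a cochain complex of `A`-modules** (`X n := A ⊗_R Pⁿ`, `d := d ⊗ A`), built on the CANONICAL `A`-module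
structure of `A ⊗_R M` (so that Mathlib's instances `Module.Finite∕Projective∕Flat` of base change and `IsScalarTower R A T` apply
verbatim — unlike `ModuleCat.extendScalars (algebraMap R A)`, whose carrier uses `RestrictScalars`).  Non-`Prop` plumbing.
[cite: MumfordAV1970, §5 Lemma 2 (p. 49)] -/
def baseChangeComplex (A : Type u) [CommRing A] [Algebra R A] (P : CochainComplex (ModuleCat.{u} R) ℤ) :
    CochainComplex (ModuleCat.{u} A) ℤ where
  X n := ModuleCat.of A (A ⊗[R] P.X n)
  d i j := ModuleCat.ofHom ((P.d i j).hom.baseChange A)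
  shape i j h := by
    ext x
    simp [P.shape i j h, LinearMap.baseChange_zero]
  d_comp_d' i j k _ _ := by
    ext x
    change ((P.d j k).hom.baseChange A) (((P.d i j).hom.baseChange A) ((1 : A) ⊗ₜ x)) = 0
    rw [LinearMap.baseChange_tmul, LinearMap.baseChange_tmul, ← ModuleCat.comp_apply, P.d_comp_d]
    simp

/-- The differentials of `A ⊗_R P•` are `d ⊗ A` (rfl). [cite: MumfordAV1970, §5 Lemma 2 (p. 49)] -/
theorem baseChangeComplex_d_hom (A : Type u) [CommRing A] [Algebra R A] (P : CochainComplex (ModuleCat.{u} R) ℤ) (i j : ℤ) :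
    ((baseChangeComplex A P).d i j).hom = (P.d i j).hom.baseChange A := rfl

/-- `A ⊗_R P•` vanishes above degree `N` when `P•` does (an additive construction preserves zero objects).
[cite: GortzWedhorn2023, Remark 21.92 (2)] -/
theorem isStrictlyLE_baseChangeComplex (A : Type u) [CommRing A] [Algebra R A] (P : CochainComplex (ModuleCat.{u} R) ℤ)
    (N : ℤ) [P.IsStrictlyLE N] : (baseChangeComplex A P).IsStrictlyLE N := by
  rw [CochainComplex.isStrictlyLE_iff]
  intro i hi
  have hz : IsZero (P.X i) := P.isZero_of_isStrictlyLE N i hi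
  haveI : Subsingleton (P.X i) := ModuleCat.subsingleton_of_isZero hz
  haveI : Subsingleton (A ⊗[R] P.X i) := inferInstance
  exact ModuleCat.isZero_of_subsingleton (ModuleCat.of A (A ⊗[R] P.X i))

/-- The terms of `A ⊗_R P•` are finite projective when those of `P•` are (Mathlib base-change instances).
[cite: MumfordAV1970, §5 Lemma 1 (p. 47)] -/
theorem finite_projective_baseChangeComplex_X (A : Type u) [CommRing A] [Algebra R A] (P : CochainComplex (ModuleCat.{u} R) ℤ)
    (hP : ∀ n, Module.Finite R (P.X n) ∧ Module.Projective R (P.X n)) (n : ℤ) :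
    Module.Finite A ((baseChangeComplex A P).X n) ∧ Module.Projective A ((baseChangeComplex A P).X n) := by
  haveI := (hP n).1
  haveI := (hP n).2
  exact ⟨inferInstanceAs (Module.Finite A (A ⊗[R] P.X n)), inferInstanceAs (Module.Projective A (A ⊗[R] P.X n))⟩

end Literature.Algebra.Homology

end
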